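import Summits.ResolutionOfSingularities.ResolutionOfSingularities.Theorems.IndSmoothSmoothToUniformizingDrBlowupStep
import Literature.AlgebraicGeometry.Resolution.AffineDomainEquidim
import HarnessLib

/-!
# The rational base `k(t, s)` is uniformized by iterated blow-ups along a discrete valuation
# (stmt-ResolutionOfSingularities-16088, line `birth`, branch DiscreteRange,
# S3 `stub_dr_rationalBase`)

Setting: `O ⊆ K` a valuation ring containing the field `k`, `t ∈ O` a uniformizer of a discrete
rank-one valuation (`v(t) < 1` and every non-zero value is an integral power of `v(t)`), every
residue of `O` algebraic over `k` (`hres`), and `{t} ∪ s ⊆ O` algebraically independent over `k`.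
Put `C₀ := k[t, s]` and `L := k(t, s) = Frac C₀`.

Theorem (`stub_dr_rationalBase`): for every finite `Z ⊆ O ∩ L` there is a finitely generated
`k`-subalgebra `C₀ ⊆ S ⊆ O ∩ L` which is REGULAR at its centre `𝔪_O ∩ S` and such that every
`z ∈ Z` is `a / b` with `a, b ∈ S`, `v(b) = 1` (i.e. `Z ⊆ S_{𝔪_O ∩ S}`).

Proof (the zero-dimensional discrete case of local uniformization, by blowing up points).

1. *Base.* The centre `𝔠₀ = 𝔪_O ∩ C₀` is generated by `t` and `n := #s` elements: every
   `y ∈ k[t, s]` is `a + t·b` with `a ∈ k[s]`; if `v(y) < 1` then `v(a) < 1`; and the centre of `O`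
   on `k[s] ≅ k[X₁, …, Xₙ]` is a maximal ideal (residues are algebraic over `k`), generated by `n`
   elements (`stub_dr_mvPolynomial_maximal_span`, S3a).
2. *Tower.* Iterate the blow-up step `stub_dr_blowupStep` (S3b): `C_{j+1} := C_j[𝔠_j / t]`. Each
   `C_j ⊆ O` is finitely generated, lies in `C₀[1/t] ⊆ L`, and its centre is again generated by
   `t` and `n` elements. Writing `z = a / b` over `C₀` with `v(b) = v(t)^e`, at each step with
   `e ≥ 1` both `a` and `b` lie in the centre (`v(a) = v(z) v(b) ≤ v(b) < 1` as `z ∈ O`) and are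
   replaced by `a / t`, `b / t ∈ C_{j+1}`; after `N = max e` steps every denominator has value `1`.
3. *Regularity by counting.* `𝔭 = 𝔪_O ∩ S` is maximal and generated by `n + 1` elements, so
   `μ(𝔭 S_𝔭) ≤ n + 1`, while `dim S_𝔭 = dim S = trdeg_k S ≥ #({t} ∪ s) = n + 1` (affine domains
   are equidimensional of dimension the transcendence degree; `{t} ∪ s ⊆ S` is algebraically
   independent). Hence `S_𝔭` is a regular local ring.

References: O. Zariski, *Local uniformization on algebraic varieties*, Ann. of Math. 41 (1940)
852–896 (the discrete rank-one case); H. Matsumura, *Commutative Ring Theory* (CUP 1986), Thm. 5.6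
and §14. Folklore.
-/

noncomputable section

-- single-problem summit: the doubled namespace component `ResolutionOfSingularities` is forced
set_option linter.dupNamespace false

open IsLocalRing

namespace Summit.ResolutionOfSingularities.ResolutionOfSingularities.Theorems.IndSmoothBirth

/-! ## The base ring `k[t, s]` and its centre -/

/-- Every element of `k[t, T]` is of the form `a + t·b` with `a ∈ k[T]` and `b ∈ k[t, T]`.
[folklore] -/
theorem exists_add_mul_of_mem_adjoin_insert {k K : Type} [Field k] [Field K] [Algebra k K]
    (t : K) (T : Set K) {y : K} (hy : y ∈ Algebra.adjoin k (insert t T)) :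
    ∃ a ∈ Algebra.adjoin k T, ∃ b ∈ Algebra.adjoin k (insert t T), y = a + t * b := by
  have hle : Algebra.adjoin k T ≤ Algebra.adjoin k (insert t T) :=
    Algebra.adjoin_mono (Set.subset_insert _ _)
  have ht : t ∈ Algebra.adjoin k (insert t T) := Algebra.subset_adjoin (Set.mem_insert _ _)
  refine Algebra.adjoin_induction
    (p := fun y _ => ∃ a ∈ Algebra.adjoin k T, ∃ b ∈ Algebra.adjoin k (insert t T), y = a + t * b)
    ?_ ?_ ?_ ?_ hy
  · rintro y (rfl | hyT)
    · exact ⟨0, zero_mem _, 1, one_mem _, by ring⟩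
    · exact ⟨y, Algebra.subset_adjoin hyT, 0, zero_mem _, by ring⟩
  · intro r
    exact ⟨algebraMap k K r, Subalgebra.algebraMap_mem _ r, 0, zero_mem _, by ring⟩
  · rintro y y' - - ⟨a, ha, b, hb, rfl⟩ ⟨a', ha', b', hb', rfl⟩
    exact ⟨a + a', add_mem ha ha', b + b', add_mem hb hb', by ring⟩
  · rintro y y' - - ⟨a, ha, b, hb, rfl⟩ ⟨a', ha', b', hb', rfl⟩
    exact ⟨a * a', mul_mem ha ha', a * b' + b * a' + t * (b * b'),
      add_mem (add_mem (mul_mem (hle ha) hb') (mul_mem hb (hle ha'))) (mul_mem ht (mul_mem hb hb')),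
      by ring⟩

/-- The centre of `O` on `k[s]`, `s` algebraically independent, is generated by `#s` elements
(transport of `stub_dr_mvPolynomial_maximal_span` along `k[s] ≅ k[X₁, …, Xₙ]`), in the form:
there are `g₁, …, gₙ ∈ k[s]` of value `< 1` such that every `a ∈ k[s]` of value `< 1` is a
`k[s]`-linear combination of them. [folklore] -/
theorem exists_centre_generators_adjoin {k K : Type} [Field k] [Field K] [Algebra k K]
    (O : ValuationSubring K)
    (hres : ∀ x : K, x ∈ O → ∃ g : Polynomial k, g.Monic ∧ O.valuation (Polynomial.aeval x g) < 1)
    (s : Finset K) (hind : AlgebraicIndependent k ((↑) : ↥(↑s : Set K) → K))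
    (hA : (Algebra.adjoin k (↑s : Set K)).toSubring ≤ O.toSubring) :
    ∃ g : Fin s.card → K, (∀ i, g i ∈ Algebra.adjoin k (↑s : Set K)) ∧
      (∀ i, O.valuation (g i) < 1) ∧
      ∀ a ∈ Algebra.adjoin k (↑s : Set K), O.valuation a < 1 →
        ∃ c : Fin s.card → K, (∀ i, c i ∈ Algebra.adjoin k (↑s : Set K)) ∧ a = ∑ i, c i * g i := by
  classical
  set A : Subalgebra k K := Algebra.adjoin k (↑s : Set K) with hAdef
  set 𝔞 : Ideal A := Ideal.comap (Subring.inclusion hA) (maximalIdeal O) with h𝔞def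
  haveI h𝔞max : 𝔞.IsMaximal := isMaximal_comap_inclusion_maximalIdeal O hres hA
  -- `A ≅ k[X₁, …, Xₙ]`
  set x : Fin s.card → K := fun i => ((s.equivFin.symm i : ↥(↑s : Set K)) : K) with hxdef
  have hx : AlgebraicIndependent k x := hind.comp _ s.equivFin.symm.injective
  have hrange : Set.range x = ↑s :=
    (s.equivFin.symm.surjective.range_comp Subtype.val).trans Subtype.range_coe
  let e : MvPolynomial (Fin s.card) k ≃ₐ[k] A :=
    hx.aevalEquiv.trans (Subalgebra.equivOfEq _ _ (by rw [hrange]))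
  set m : Ideal (MvPolynomial (Fin s.card) k) := Ideal.comap e 𝔞 with hmdef
  haveI : m.IsMaximal := Ideal.comap_isMaximal_of_equiv e
  obtain ⟨g₀, hg₀⟩ := stub_dr_mvPolynomial_maximal_span k s.card m ‹_›
  have h𝔞 : 𝔞 = Ideal.span (Set.range fun i => e (g₀ i)) := by
    have h1 : 𝔞 = m.map e := (Ideal.map_comap_of_surjective e e.surjective _).symm
    rw [h1, hg₀, Ideal.map_span, ← Set.range_comp]
    rfl
  refine ⟨fun i => ((e (g₀ i) : A) : K), fun i => (e (g₀ i)).2, fun i => ?_, fun a haA hva => ?_⟩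
  · have hi : e (g₀ i) ∈ 𝔞 := h𝔞 ▸ Ideal.subset_span ⟨i, rfl⟩
    exact (mem_comap_inclusion_maximalIdeal_iff O hA _).mp hi
  · have ha𝔞 : (⟨a, haA⟩ : A) ∈ 𝔞 := (mem_comap_inclusion_maximalIdeal_iff O hA _).mpr hva
    rw [h𝔞] at ha𝔞
    obtain ⟨c, hc⟩ := Ideal.mem_span_range_iff_exists_fun.mp ha𝔞
    refine ⟨fun i => ((c i : A) : K), fun i => (c i).2, ?_⟩
    simpa using (congr_arg Subtype.val hc).symm

/-- **Base of the tower.** The centre of `O` on `C₀ = k[t, s]` (`{t} ∪ s` with `s`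
algebraically independent, `v(t) < 1`) is generated by `t` and `#s` further elements: writing
`y = a + t·b` with `a ∈ k[s]`, `v(y) < 1` forces `v(a) < 1`, and the centre of `O` on `k[s]` needs
`#s` generators. [folklore] -/
theorem exists_span_eq_centre_adjoin_insert {k K : Type} [Field k] [Field K] [Algebra k K]
    (O : ValuationSubring K)
    (hres : ∀ x : K, x ∈ O → ∃ g : Polynomial k, g.Monic ∧ O.valuation (Polynomial.aeval x g) < 1)
    (t : K) (hlt : O.valuation t < 1) (s : Finset K)
    (hind : AlgebraicIndependent k ((↑) : ↥(↑s : Set K) → K))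
    (hC₀ : (Algebra.adjoin k (insert t (↑s : Set K))).toSubring ≤ O.toSubring) :
    ∃ (htC : t ∈ Algebra.adjoin k (insert t (↑s : Set K))) (g : Fin s.card → K)
      (hg : ∀ i, g i ∈ Algebra.adjoin k (insert t (↑s : Set K))),
      Ideal.span (insert (⟨t, htC⟩ : ↥(Algebra.adjoin k (insert t (↑s : Set K))))
        (Set.range fun i => (⟨g i, hg i⟩ : ↥(Algebra.adjoin k (insert t (↑s : Set K)))))) =
        Ideal.comap (Subring.inclusion hC₀) (maximalIdeal O) := by
  classical
  set C₀ : Subalgebra k K := Algebra.adjoin k (insert t (↑s : Set K)) with hC₀def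
  have hle : Algebra.adjoin k (↑s : Set K) ≤ C₀ := Algebra.adjoin_mono (Set.subset_insert _ _)
  have hA : (Algebra.adjoin k (↑s : Set K)).toSubring ≤ O.toSubring := fun y hy => hC₀ (hle hy)
  have htC : t ∈ C₀ := Algebra.subset_adjoin (Set.mem_insert _ _)
  obtain ⟨g, hgA, hvg, hgen⟩ := exists_centre_generators_adjoin O hres s hind hA
  refine ⟨htC, g, fun i => hle (hgA i), le_antisymm ?_ ?_⟩
  · rw [Ideal.span_le]
    rintro _ (rfl | ⟨i, rfl⟩)
    · exact (mem_comap_inclusion_maximalIdeal_iff O hC₀ _).mpr hlt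
    · exact (mem_comap_inclusion_maximalIdeal_iff O hC₀ _).mpr (hvg i)
  · rintro ⟨y, hyC⟩ hy
    have hvy : O.valuation y < 1 := (mem_comap_inclusion_maximalIdeal_iff O hC₀ _).mp hy
    obtain ⟨a, haA, b, hbC, rfl⟩ := exists_add_mul_of_mem_adjoin_insert t (↑s : Set K) hyC
    have hvb : O.valuation b ≤ 1 := (O.valuation_le_one_iff b).mpr (hC₀ hbC)
    have hvtb : O.valuation (t * b) < 1 := by
      rw [Valuation.map_mul]
      exact Left.mul_lt_one_of_lt_of_le hlt hvb
    have hva : O.valuation a < 1 := by simpa using O.valuation.map_sub_lt hvy hvtb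
    obtain ⟨c, hcA, hac⟩ := hgen a haA hva
    have hsplit : (⟨a + t * b, hyC⟩ : C₀) =
        ∑ i, (⟨c i, hle (hcA i)⟩ : C₀) * ⟨g i, hle (hgA i)⟩ + ⟨b, hbC⟩ * ⟨t, htC⟩ := by
      apply Subtype.ext
      simp only [Subalgebra.coe_add, Subalgebra.coe_mul]
      rw [hac, mul_comm t b]
      congr 1
      simp
    rw [hsplit]
    refine Ideal.add_mem _ (Ideal.sum_mem _ fun i _ => Ideal.mul_mem_left _ _
      (Ideal.subset_span (Set.mem_insert_of_mem _ ⟨i, rfl⟩))) ?_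
    exact Ideal.mul_mem_left _ _ (Ideal.subset_span (Set.mem_insert _ _))

/-- Elements of `k(T)` are quotients `a / b` of elements of `k[T]` with `v(b) = v(t)^e`, `e : ℕ`,
along a discrete valuation with uniformizer `t` for which `k[T] ⊆ O`. [folklore] -/
theorem exists_div_eq_of_mem_intermediateField_adjoin {k K : Type} [Field k] [Field K]
    [Algebra k K] (O : ValuationSubring K) (t : K) (ht0 : t ≠ 0)
    (hunif : ∀ x : K, x ≠ 0 → ∃ n : ℤ, O.valuation x = O.valuation t ^ n)
    (hlt : O.valuation t < 1) (T : Set K) (hC₀ : (Algebra.adjoin k T).toSubring ≤ O.toSubring)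
    {z : K} (hz : z ∈ IntermediateField.adjoin k T) :
    ∃ a ∈ Algebra.adjoin k T, ∃ b ∈ Algebra.adjoin k T, ∃ e : ℕ,
      z = a / b ∧ O.valuation b = O.valuation t ^ e := by
  obtain ⟨a, ha, b, hb, rfl⟩ := IntermediateField.mem_adjoin_iff_div.mp hz
  rcases eq_or_ne b 0 with rfl | hb0
  · exact ⟨0, zero_mem _, 1, one_mem _, 0, by rw [div_zero, zero_div], by
      rw [Valuation.map_one, pow_zero]⟩
  obtain ⟨m, hm⟩ := hunif b hb0
  have hvt0 : O.valuation t ≠ 0 := (Valuation.ne_zero_iff _).mpr ht0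
  have hm0 : 0 ≤ m := by
    by_contra hneg
    have h1 : 1 < O.valuation t ^ m := one_lt_zpow_of_neg₀ (zero_lt_iff.mpr hvt0) hlt (by omega)
    rw [← hm] at h1
    exact absurd ((O.valuation_le_one_iff b).mpr (hC₀ hb)) (not_le.mpr h1)
  refine ⟨a, ha, b, hb, m.toNat, rfl, ?_⟩
  rw [hm, ← zpow_natCast, Int.toNat_of_nonneg hm0]

/-! ## The tower of blow-ups -/

/-- **The tower of blow-ups.** Iterating `stub_dr_blowupStep` `j` times from `C₀` (centre
generated by `t` and `n` elements, every `z ∈ Z` written `a / b` over `C₀` with `v(b) = v(t)^e`,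
`e ≤ N`): the `j`-th ring `C_j ⊆ O` is finitely generated, lies in `C₀[1/t]`, its centre is still
generated by `t` and `n` elements, and every `z ∈ Z ∩ O` is `a / b` over `C_j` with
`v(b) = v(t)^e`, `e ≤ N - j` (divide `a` and `b` by `t` at each step while `e ≥ 1`). [folklore] -/
theorem exists_blowupTower {k K : Type} [Field k] [Field K] [Algebra k K]
    (O : ValuationSubring K) (t : K) (ht0 : t ≠ 0) (htO : t ∈ O)
    (hunif : ∀ x : K, x ≠ 0 → ∃ n : ℤ, O.valuation x = O.valuation t ^ n)
    (hlt : O.valuation t < 1)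
    (hres : ∀ x : K, x ∈ O → ∃ g : Polynomial k, g.Monic ∧ O.valuation (Polynomial.aeval x g) < 1)
    (C₀ : Subalgebra k K) (hC₀ : C₀.toSubring ≤ O.toSubring) (hC₀fg : C₀.FG) (htC₀ : t ∈ C₀)
    (n : ℕ) (g₀ : Fin n → K) (hg₀ : ∀ i, g₀ i ∈ C₀)
    (hspan₀ : Ideal.span (insert (⟨t, htC₀⟩ : C₀) (Set.range fun i => (⟨g₀ i, hg₀ i⟩ : C₀))) =
      Ideal.comap (Subring.inclusion hC₀) (maximalIdeal O))
    (Z : Finset K) (hZO : ∀ z ∈ Z, z ∈ O) (N : ℕ)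
    (hZ : ∀ z ∈ Z, ∃ a ∈ C₀, ∃ b ∈ C₀, ∃ e : ℕ,
      z = a / b ∧ O.valuation b = O.valuation t ^ e ∧ e ≤ N)
    (j : ℕ) :
    ∃ (C : Subalgebra k K) (hC : C.toSubring ≤ O.toSubring), C.FG ∧ C₀ ≤ C ∧
      (∀ x ∈ C, ∃ a ∈ C₀, ∃ m : ℕ, x * t ^ m = a) ∧
      (∃ (htC : t ∈ C) (g : Fin n → K) (hg : ∀ i, g i ∈ C),
        Ideal.span (insert (⟨t, htC⟩ : C) (Set.range fun i => (⟨g i, hg i⟩ : C))) =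
          Ideal.comap (Subring.inclusion hC) (maximalIdeal O)) ∧
      ∀ z ∈ Z, ∃ a ∈ C, ∃ b ∈ C, ∃ e : ℕ,
        z = a / b ∧ O.valuation b = O.valuation t ^ e ∧ e ≤ N - j := by
  induction j with
  | zero =>
    exact ⟨C₀, hC₀, hC₀fg, le_rfl, fun x hx => ⟨x, hx, 0, by rw [pow_zero, mul_one]⟩,
      ⟨htC₀, g₀, hg₀, hspan₀⟩, fun z hz => by simpa only [Nat.sub_zero] using hZ z hz⟩
  | succ j ih =>
    obtain ⟨C, hC, hCfg, hC₀C, hbir, ⟨htC, g, hg, hspan⟩, hZC⟩ := ih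
    obtain ⟨C', hC', hC'fg, hCC', hbir', htC', g', hg', hspan', hdiv⟩ :=
      stub_dr_blowupStep k K O t htO hunif hlt hres C hC hCfg htC n g hg hspan
    refine ⟨C', hC', hC'fg, hC₀C.trans hCC', ?_, ⟨htC', g', hg', hspan'⟩, ?_⟩
    · intro x hx
      obtain ⟨a, haC, m, hxa⟩ := hbir' x hx
      obtain ⟨a₀, ha₀, m', haa₀⟩ := hbir a haC
      exact ⟨a₀, ha₀, m + m', by rw [pow_add, ← mul_assoc, hxa, haa₀]⟩
    · intro z hz
      obtain ⟨a, haC, b, hbC, e, hzab, hvb, he⟩ := hZC z hz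
      rcases Nat.eq_zero_or_pos e with rfl | hepos
      · exact ⟨a, hCC' haC, b, hCC' hbC, 0, hzab, hvb, Nat.zero_le _⟩
      · -- `e ≥ 1`: `v(b) < 1` and `v(a) ≤ v(b) < 1`, so `a/t, b/t ∈ C'`
        have hvt0 : O.valuation t ≠ 0 := (Valuation.ne_zero_iff _).mpr ht0
        have hvb1 : O.valuation b < 1 := by
          rw [hvb]
          exact pow_lt_one₀ zero_le hlt (Nat.pos_iff_ne_zero.mp hepos)
        have hb0 : b ≠ 0 := by
          rintro rfl
          rw [Valuation.map_zero] at hvb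
          exact pow_ne_zero e hvt0 hvb.symm
        have hva1 : O.valuation a < 1 := by
          have h1 : a = z * b := by rw [hzab, div_mul_cancel₀ a hb0]
          rw [h1, Valuation.map_mul]
          calc O.valuation z * O.valuation b ≤ 1 * O.valuation b :=
                mul_le_mul_left ((O.valuation_le_one_iff z).mpr (hZO z hz)) _
            _ < 1 := by rw [one_mul]; exact hvb1
        refine ⟨a / t, hdiv a haC hva1, b / t, hdiv b hbC hvb1, e - 1, ?_, ?_, by omega⟩
        · rw [hzab, div_div_div_cancel_right₀ ht0]
        · obtain ⟨e', rfl⟩ : ∃ e', e = e' + 1 := ⟨e - 1, by omega⟩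
          rw [map_div₀, hvb, pow_succ, mul_div_cancel_right₀ _ hvt0, Nat.add_sub_cancel]

/-! ## Regularity of the top of the tower -/

/-- **Regularity by counting generators against dimension.** If the centre `𝔭 = 𝔪_O ∩ S` of `O`
on a finitely generated `k`-subalgebra `S ⊆ O` (residues algebraic over `k`, so `𝔭` is maximal)
is generated by `n + 1` elements and `dim S ≥ n + 1`, then `S_𝔭` is a regular local ring:
`μ(𝔭 S_𝔭) ≤ n + 1 ≤ dim S = dim S_𝔭` (affine domains are equidimensional). [folklore] -/
theorem isRegularLocalRing_centre_of_span_eq {k K : Type} [Field k] [Field K] [Algebra k K]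
    (O : ValuationSubring K)
    (hres : ∀ x : K, x ∈ O → ∃ g : Polynomial k, g.Monic ∧ O.valuation (Polynomial.aeval x g) < 1)
    (S : Subalgebra k K) (hS : S.toSubring ≤ O.toSubring) (hfg : S.FG) {t : K} (htS : t ∈ S)
    {n : ℕ} (g : Fin n → K) (hg : ∀ i, g i ∈ S)
    (hspan : Ideal.span (insert (⟨t, htS⟩ : S) (Set.range fun i => (⟨g i, hg i⟩ : S))) =
      Ideal.comap (Subring.inclusion hS) (maximalIdeal O))
    (hdim : ((n + 1 : ℕ) : WithBot ℕ∞) ≤ ringKrullDim S) :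
    IsRegularLocalRing
      (Localization.AtPrime (Ideal.comap (Subring.inclusion hS) (maximalIdeal O))) := by
  classical
  set p : Ideal S := Ideal.comap (Subring.inclusion hS) (maximalIdeal O) with hpdef
  haveI hpmax : p.IsMaximal := isMaximal_comap_inclusion_maximalIdeal O hres hS
  haveI : Algebra.FiniteType k S := S.fg_iff_finiteType.mp hfg
  haveI : IsNoetherianRing S := Algebra.FiniteType.isNoetherianRing k S
  refine IsRegularLocalRing.of_spanFinrank_maximalIdeal_le _ ?_
  set G : Set S := insert (⟨t, htS⟩ : S) (Set.range fun i => (⟨g i, hg i⟩ : S)) with hGdef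
  have hgen : maximalIdeal (Localization.AtPrime p) =
      Ideal.span ((algebraMap S (Localization.AtPrime p)) '' G) := by
    rw [← Localization.AtPrime.map_eq_maximalIdeal, ← Ideal.map_span]
    exact congrArg (Ideal.map (algebraMap S (Localization.AtPrime p))) hspan.symm
  have hfin : G.Finite := (Set.finite_range _).insert _
  have hcard : G.ncard ≤ n + 1 := by
    have h1 : (Set.range fun i => (⟨g i, hg i⟩ : S)).ncard ≤ n := by
      rw [← Nat.card_coe_set_eq]
      exact (Finite.card_range_le _).trans_eq (by simp)
    exact (Set.ncard_insert_le _ _).trans (by omega)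
  have hle : (maximalIdeal (Localization.AtPrime p)).spanFinrank ≤ n + 1 := by
    rw [hgen]
    calc _ ≤ ((algebraMap S (Localization.AtPrime p)) '' G).ncard :=
          Submodule.spanFinrank_span_le_ncard_of_finite (hfin.image _)
      _ ≤ G.ncard := Set.ncard_image_le hfin
      _ ≤ n + 1 := hcard
  calc ((maximalIdeal (Localization.AtPrime p)).spanFinrank : WithBot ℕ∞)
        ≤ ((n + 1 : ℕ) : WithBot ℕ∞) := by exact_mod_cast hle
    _ ≤ ringKrullDim S := hdim
    _ = ringKrullDim (Localization.AtPrime p) :=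
        (Literature.AlgebraicGeometry.Resolution.ringKrullDim_localization_atPrime_eq_of_isMaximal
          k p).symm

/-- **Dimension of the models.** A finitely generated `k`-subalgebra `S ⊆ K` containing an
algebraically independent set `{t} ∪ s` (`t ∉ s`) has `dim S = trdeg_k S ≥ #s + 1`. [folklore] -/
theorem card_succ_le_ringKrullDim {k K : Type} [Field k] [Field K] [Algebra k K]
    (S : Subalgebra k K) (hfg : S.FG) (t : K) (s : Finset K) (hts : t ∉ s)
    (hind : AlgebraicIndependent k ((↑) : ↥(insert t (↑s : Set K)) → K))
    (hsub : insert t (↑s : Set K) ⊆ S) :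
    ((s.card + 1 : ℕ) : WithBot ℕ∞) ≤ ringKrullDim S := by
  classical
  haveI : Algebra.FiniteType k S := S.fg_iff_finiteType.mp hfg
  obtain ⟨m, hdim, htr⟩ :=
    Literature.AlgebraicGeometry.Resolution.exists_ringKrullDim_eq_and_trdeg_eq k S
  have hy : AlgebraicIndependent k fun i : ↥(insert t (↑s : Set K)) => (⟨i, hsub i.2⟩ : S) :=
    AlgebraicIndependent.of_comp S.val hind
  have hcard : Cardinal.mk ↥(insert t (↑s : Set K)) ≤ Algebra.trdeg k S := hy.cardinalMk_le_trdeg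
  have hmk : Cardinal.mk ↥(insert t (↑s : Set K)) = ((s.card + 1 : ℕ) : Cardinal) := by
    rw [Cardinal.mk_insert (by exact_mod_cast hts)]
    simp
  rw [htr, hmk] at hcard
  have h : s.card + 1 ≤ m := by exact_mod_cast hcard
  rw [hdim]
  exact_mod_cast h

/-! ## The rational base -/

/-- **S3 — local uniformization of the rational base `L = k(t, s)` along a discrete valuation by
iterated blow-ups.** Let `O ⊆ K` be a valuation ring containing `k`, `t ∈ O` a uniformizer of a
discrete valuation (`hunif`, `hlt`) with residues algebraic over `k` (`hres`), and `{t} ∪ s ⊆ O`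
algebraically independent over `k`. Then every finite `Z ⊆ O ∩ k(t, s)` consists of fractions
`a / b` with `a, b ∈ S`, `v(b) = 1`, for a finitely generated `k`-subalgebra
`k[t, s] ⊆ S ⊆ O ∩ k(t, s)` which is REGULAR at its centre `𝔪_O ∩ S`. Proof: blow up
`C₀ = k[t, s]` at its centre `N` times in the `t`-chart (`stub_dr_blowupStep`), `N` the largest
`t`-order of a denominator of `Z`; the centre stays generated by `t` and `#s` elements while
`dim = trdeg = #s + 1`, whence regularity. [folklore] -/
theorem stub_dr_rationalBase (k K : Type) [Field k] [Field K] [Algebra k K]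
    (O : ValuationSubring K) (hO : ∀ c : k, algebraMap k K c ∈ O) (t : K) (s : Finset K)
    (htO : t ∈ O) (hsO : ∀ y ∈ s, y ∈ O) (hts : t ∉ s)
    (hind : AlgebraicIndependent k ((↑) : ↥(insert t (↑s : Set K)) → K))
    (hunif : ∀ x : K, x ≠ 0 → ∃ n : ℤ, O.valuation x = O.valuation t ^ n)
    (hlt : O.valuation t < 1)
    (hres : ∀ x : K, x ∈ O → ∃ g : Polynomial k, g.Monic ∧ O.valuation (Polynomial.aeval x g) < 1)
    (Z : Finset K)
    (hZ : ∀ z ∈ Z, z ∈ O ∧ z ∈ IntermediateField.adjoin k (insert t (↑s : Set K))) :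
    ∃ (S : Subalgebra k K) (hS : S.toSubring ≤ O.toSubring), S.FG ∧
      (S : Set K) ⊆ IntermediateField.adjoin k (insert t (↑s : Set K)) ∧
      insert t (↑s : Set K) ⊆ S ∧
      IsRegularLocalRing (Localization.AtPrime
        (Ideal.comap (Subring.inclusion hS) (IsLocalRing.maximalIdeal O))) ∧
      ∀ z ∈ Z, ∃ a ∈ S, ∃ b ∈ S, O.valuation b = 1 ∧ z = a / b := by
  classical
  have ht0 : t ≠ 0 := hind.ne_zero ⟨t, Set.mem_insert _ _⟩
  -- the base ring `C₀ = k[t, s] ⊆ O`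
  set C₀ : Subalgebra k K := Algebra.adjoin k (insert t (↑s : Set K)) with hC₀def
  have hC₀ : C₀.toSubring ≤ O.toSubring := fun y hy =>
    Algebra.adjoin_le (S := ⟨O.toSubring.toSubsemiring, hO⟩)
      (Set.insert_subset htO fun y hy => hsO y hy) hy
  have hC₀fg : C₀.FG := Subalgebra.fg_def.mpr ⟨_, s.finite_toSet.insert t, rfl⟩
  have hsub₀ : insert t (↑s : Set K) ⊆ C₀ := Algebra.subset_adjoin
  -- the base centre is generated by `t` and `#s` further elements
  obtain ⟨htC₀, g₀, hg₀, hspan₀⟩ :=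
    exists_span_eq_centre_adjoin_insert O hres t hlt s (hind.mono (Set.subset_insert _ _)) hC₀
  -- the elements of `Z` as fractions over `C₀`, and the number `N` of blow-ups
  have hrep : ∀ z ∈ Z, ∃ a ∈ C₀, ∃ b ∈ C₀, ∃ e : ℕ,
      z = a / b ∧ O.valuation b = O.valuation t ^ e := fun z hz =>
    exists_div_eq_of_mem_intermediateField_adjoin O t ht0 hunif hlt _ hC₀ (hZ z hz).2
  choose! fa hfa fb hfb fe hfe using hrep
  set N : ℕ := Z.sup fe with hNdef
  have hZ' : ∀ z ∈ Z, ∃ a ∈ C₀, ∃ b ∈ C₀, ∃ e : ℕ,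
      z = a / b ∧ O.valuation b = O.valuation t ^ e ∧ e ≤ N := fun z hz =>
    ⟨fa z, hfa z hz, fb z, hfb z hz, fe z, (hfe z hz).1, (hfe z hz).2, Finset.le_sup hz⟩
  -- blow up `N` times
  obtain ⟨S, hS, hSfg, hC₀S, hbir, ⟨htS, g, hg, hspan⟩, hZS⟩ :=
    exists_blowupTower O t ht0 htO hunif hlt hres C₀ hC₀ hC₀fg htC₀ s.card g₀ hg₀ hspan₀ Z
      (fun z hz => (hZ z hz).1) N hZ' N
  refine ⟨S, hS, hSfg, ?_, hsub₀.trans hC₀S, ?_, ?_⟩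
  · -- `S ⊆ C₀[1/t] ⊆ k(t, s)`
    intro x hx
    obtain ⟨a, ha, m, hxa⟩ := hbir x hx
    have hle : C₀ ≤ (IntermediateField.adjoin k (insert t (↑s : Set K))).toSubalgebra :=
      IntermediateField.algebra_adjoin_le_adjoin k _
    have haF : a ∈ IntermediateField.adjoin k (insert t (↑s : Set K)) := hle ha
    have htF : t ∈ IntermediateField.adjoin k (insert t (↑s : Set K)) := hle htC₀
    have hx' : x = a / t ^ m := by rw [← hxa, mul_div_cancel_right₀ x (pow_ne_zero m ht0)]
    rw [SetLike.mem_coe, hx']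
    exact div_mem haF (pow_mem htF m)
  · -- regular at the centre: `n + 1` generators, dimension `n + 1`
    exact isRegularLocalRing_centre_of_span_eq O hres S hS hSfg htS g hg hspan
      (card_succ_le_ringKrullDim S hSfg t s hts hind (hsub₀.trans hC₀S))
  · -- after `N` steps all denominators are units at the centre
    intro z hz
    obtain ⟨a, ha, b, hb, e, hzab, hvb, he⟩ := hZS z hz
    obtain rfl : e = 0 := by omega
    exact ⟨a, ha, b, hb, by rw [hvb, pow_zero], hzab⟩

end Summit.ResolutionOfSingularities.ResolutionOfSingularities.Theorems.IndSmoothBirth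

end
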